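import Mathlib
import Summits.NavierStokesRegularity.NavierStokesRegularity.Theses.SubOnsagerCeiling
import Literature.Analysis.FluidPDE.Tao2016AveragedNS.SelfSimilarCascadeBlowup
import HarnessLib

/-!
# The rung target of route SubOnsagerCeiling needs the KP forward-source ceiling ONLY AT SMALL SCALE RATIOS
# (helper file for the crux `SubOnsagerCeiling.ForwardTailCeilingKP`, stmt-NavierStokesRegularity-27057, `--supports`;
# hand leafhand-ns-subonsagerceiling-4 gen 22 — a by-name REDUCTION for the planner, no new analysis)

The route's deciding theorem `Theses.SubOnsagerCeiling.closes` concludes the rung-`TL-M2Break` leaf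
`Theses.TaoLadderRungTwoBreak.Target = ∀ R ≥ 1, ∃ εR > 0, ∀ ε₀ ∈ (0, εR], ∀ α ∈ E₂(R), ∀ X₀, ¬NoGlobalCascade ε₀ α X₀` — a
statement about all SUFFICIENTLY SMALL scale ratios `1 + ε₀` only — from the crux `ForwardTailCeilingKP` (item 27057), which is typed
for EVERY `ε₀ ∈ (0, 1]`.  The proof of the glue item `KPBreakOfCeiling` (p-landed `subOnsagerCeiling_kpBreakOfCeiling_proof`) consumes
the crux one table and one ratio at a time.  This file records the consequence BY NAME:

* `kp_not_noGlobalCascade_of_fwdCeilingKPAt` — PER TABLE, PER RATIO: the body `FwdCeilingKPAt R ε₀ α` of the crux at ONE `(R, ε₀, α)`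
  (a forward-source set `S ⊇ S⁺(α)`, `θ > 1/2`, `C ≥ 0` before `ν`), together with the CLOSED items `OrthantInvariance`
  (hypothesis; proved as `subOnsagerCeiling_orthantInvariance_proof`) and `ForwardSourceSmoothing` (`ForwardSourceSmoothing_holds`,
  discharged here), gives `¬NoGlobalCascade ε₀ α X₀` for every one-shell datum (verbatim the argument of
  `subOnsagerCeiling_kpBreakOfCeiling_proof`);
* **`taoLadderTarget_of_kpSmallRatioCeiling`** — the rung target follows from the two declared residuals `NonDiagonalOrthantBreak`
  (stmt-27000), `NonOrthantBreak` (stmt-24640) and the **SMALL-RATIO KP CEILING**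
  `∀ R ≥ 1, ∃ εR > 0, ∀ ε₀ ∈ (0, εR], ∀ α, FwdCeilingKPAt R ε₀ α` ALONE — the crux restricted to an `R`-dependent neighbourhood of the
  continuum limit `b = 1 + ε₀ ↓ 1` (plus the closed item `OrthantInvariance` as a hypothesis);
* `kpSmallRatioCeiling_of_forwardTailCeilingKP` — the typed crux implies the small-ratio ceiling (`εR = 1`), so nothing is lost.

READING (for the planner; numbers = the hands' census on item 27057): the registered stubs split the typed crux at `ε₀ = 1/4`; STUB 1
(`1/4 < ε₀ ≤ 1`, where 22 generations of chain-descent certificates live, `b ∈ [5/4, 2]`) is NOT NEEDED by the route at all, and of STUB 2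
only the germ at `ε₀ ↓ 0` is needed.  The by-name blocker of the typed crux — the Katz–Pavlović chain first-passage factor on the window
`b ∈ (1.035, 1.3)` with numerical margins `< 1%` (hands 4-g13/4-g15/4-g16) — lies OUTSIDE what the route consumes if `εR ≤ 0.03`; in the
regime the route needs, the hands measure the K41-slaved lattice shock (`θ_f = 5/6`, `D ≈ 1`, running-max principle `R ≤ 1`, exponent
margin `1/3` over the kill line `1/2`).  HONEST FRAMING: a reduction between statements about Tao-type MODEL lattice ODEs (route
SubOnsagerCeiling, rung TL-M2Break); the small-ratio ceiling is OPEN (it contains a λ ↓ 1 Barbato–Morandin–Romito-type statement, not in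
print); no stub, crux, rung target or summit is proved here and nothing bears on Navier–Stokes regularity.
[cite: Tao2016AveragedNS, §4 (4.13), Thm. 4.2] [cite: BarbatoMorandinRomito2011, §3.2]
-/

noncomputable section

-- the sub-problem namespace `NavierStokesRegularity.NavierStokesRegularity` is the tree's layout (D-0017)
set_option linter.dupNamespace false

namespace Summit.NavierStokesRegularity.NavierStokesRegularity.Theorems

open Set Filter
open scoped Topology
open Literature.Analysis.FluidPDE.TaoCascade
open Summit.NavierStokesRegularity.NavierStokesRegularity.Theses.SubOnsagerCeiling

/-- **Per table, per ratio: the KP forward-source ceiling forbids Theorem-4.2 blow-up.**  If the orthant diagonal-feed table `α ∈ E₂(R)`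
obeys the body of the crux at the scale ratio `1 + ε₀` (forward-source set `S`, `θ > 1/2`, `C ≥ 0` before `ν`), then
`¬NoGlobalCascade ε₀ α X₀` for every one-shell datum: the ceiling is an `S`-envelope with `η = 2θ − 1 > 0` and horizon-free constant
`C·E₀` at `ν = κ/√2` (non-negativity from the closed item `OrthantInvariance`), `ForwardSourceSmoothing` (closed) gives a global regular
viscous solution, hence a global `(κ, κ)`-pseudo-solution. Verbatim the argument of `subOnsagerCeiling_kpBreakOfCeiling_proof`, with
`ForwardSourceSmoothing` discharged by `ForwardSourceSmoothing_holds`. MODEL lattice statement. [cite: Tao2016AveragedNS, §4 Thm. 4.2] -/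
theorem kp_not_noGlobalCascade_of_fwdCeilingKPAt {R ε₀ : ℝ} (hε₀ : 0 < ε₀)
    {α : Fin 4 → Fin 4 → Fin 4 → ℤ × ℤ × ℤ → ℝ}
    (hC : Literature.Analysis.FluidPDE.TaoCascade.InTableClass R α → (∀ (Y : Fin 4 → ℤ → ℝ → ℝ) (τ : ℝ), (∀ (j : Fin 4) (k : ℤ), 1 ≤ k → 0 ≤ Y j k τ) → ∀ δ : ℝ, 0 < δ → ∀ (i : Fin 4) (n : ℤ), 1 ≤ n → Y i n τ = 0 → 0 ≤ Literature.Analysis.FluidPDE.TaoCascade.quadTerm δ α Y i n τ) → (∀ a b i : Fin 4, a ≠ b → α a b i (0, 0, 1) = 0) → ∃ S : Finset (Fin 4), (∀ i, i ∉ S → ∀ j l : Fin 4, α i j l (0, 0, 1) = 0) ∧ ∃ θ : ℝ, 1 / 2 < θ ∧ ∃ C : ℝ, 0 ≤ C ∧ ∀ ν : ℝ, 0 < ν → ∀ (X₀ : Fin 4 → ℝ) (s : ℝ), 0 < s → ∀ X : Fin 4 → ℤ → ℝ → ℝ, (∀ (i : Fin 4) (k : ℤ), X i k 0 = if k = 0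 then X₀ i else 0) → (∀ (i : Fin 4) (k : ℤ), k < 0 → ∀ t : ℝ, X i k t = 0) → (∃ M : ℝ, ∀ (t : ℝ) (i : Fin 4) (k : ℤ), (1 + (1 + ε₀) ^ ((10 : ℝ) * k)) * |X i k t| ≤ M) → (∀ (i : Fin 4) (k : ℤ), Continuous (X i k)) → (∀ (i : Fin 4) (k : ℤ), ∀ t ∈ Set.Icc (0 : ℝ) s, HasDerivWithinAt (X i k) (Literature.Analysis.FluidPDE.TaoCascade.quadTerm ε₀ α X i k t - ν * (1 + ε₀) ^ ((2 : ℝ) * k) * X i k t) (Set.Icc (0 : ℝ) s) t) → (∀ t ∈ Set.Icc (0 : ℝ) s, ∀ (i : Fin 4) (k : ℤ), 1 ≤ k → 0 ≤ X i k t) → ∀ n N : ℕ, n ≤ N → ∀ t ∈ Set.Icc (0 : ℝ) s, ∑ k ∈ Finset.Icc n N, ∑ i ∈ S, (1 / 2 : ℝ) * X i (k : ℤ) t ^ 2 ≤ C * (∑ i : Fin 4, (1 / 2 : ℝ) * X₀ i ^ 2) * (1 + ε₀) ^ (-(2 * θ * (n : ℝ))))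
    (hα : Literature.Analysis.FluidPDE.TaoCascade.InTableClass R α)
    (hK : ∀ (Y : Fin 4 → ℤ → ℝ → ℝ) (τ : ℝ), (∀ (j : Fin 4) (k : ℤ), 1 ≤ k → 0 ≤ Y j k τ) → ∀ δ : ℝ, 0 < δ →
      ∀ (i : Fin 4) (n : ℤ), 1 ≤ n → Y i n τ = 0 → 0 ≤ Literature.Analysis.FluidPDE.TaoCascade.quadTerm δ α Y i n τ)
    (hD : ∀ a b i : Fin 4, a ≠ b → α a b i (0, 0, 1) = 0) (hI : OrthantInvariance) (X₀ : Fin 4 → ℝ) :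
    ¬ Literature.Analysis.FluidPDE.TaoCascade.NoGlobalCascade ε₀ α X₀ := by
  have hB : ForwardSourceSmoothing := ForwardSourceSmoothing_holds
  unfold Summit.NavierStokesRegularity.NavierStokesRegularity.Theses.SubOnsagerCeiling.OrthantInvariance at hI
  unfold Summit.NavierStokesRegularity.NavierStokesRegularity.Theses.SubOnsagerCeiling.ForwardSourceSmoothing at hB
  intro hNG
  obtain ⟨κ, hκ, hno⟩ := (noGlobalCascade_iff_kappa hε₀).1 hNG
  have h2 : 0 < Real.sqrt 2 := Real.sqrt_pos.2 two_pos
  have hν : 0 < κ / Real.sqrt 2 := div_pos hκ h2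
  -- the forward-source ceiling of the orthant diagonal-feed table `α` at scale ratio `1 + ε₀`
  obtain ⟨S, hS, θ, hθ, C, _hC0, H⟩ := hC hα hK hD
  -- the subcritical envelope exponent `η = 2θ - 1 > 0`
  have hη : 0 < 2 * θ - 1 := by linarith
  obtain ⟨X, hX⟩ := hB ε₀ (2 * θ - 1) R hε₀ hη α hα S hS X₀ (κ / Real.sqrt 2) hν
    (fun T _hT => ⟨C * (∑ i : Fin 4, (1 / 2 : ℝ) * X₀ i ^ 2),
      fun s hs Y hinit hlow hbd hcont hder n N hnN t ht => by
        have hnonneg := hI ε₀ (κ / Real.sqrt 2) hε₀ hν α hK X₀ s hs.1 Y hinit hlow hbd hcont hder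
        have hceil := H (κ / Real.sqrt 2) hν X₀ s hs.1 Y hinit hlow hbd hcont hder hnonneg n N hnN
          t ht
        have hexp : -((1 + (2 * θ - 1)) * (n : ℝ)) = -(2 * θ * (n : ℝ)) := by ring
        rw [hexp]
        exact hceil⟩)
  have hG := hasGlobal_of_viscousGlobal hε₀ hν.le hX
  rw [div_mul_cancel₀ κ h2.ne'] at hG
  exact hno (hasGlobal_mono hε₀.le hG le_rfl hκ.le)

/-- **THE RUNG TARGET FROM THE SMALL-RATIO KP CEILING.**  `Theses.TaoLadderRungTwoBreak.Target` follows from the two declared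
residual cruxes `NonDiagonalOrthantBreak` (stmt-27000) and `NonOrthantBreak` (stmt-24640) of route SubOnsagerCeiling together with the
KP forward-source ceiling at SMALL SCALE RATIOS ONLY: `∀ R ≥ 1, ∃ εR > 0, ∀ ε₀ ∈ (0, εR], ∀ α, FwdCeilingKPAt R ε₀ α` (the crux
`ForwardTailCeilingKP` restricted to an `R`-dependent neighbourhood of the continuum limit `1 + ε₀ ↓ 1`).  Same three-way case split
as the route's deciding theorem `Theses.SubOnsagerCeiling.closes`, with the threshold `min εR (min ε₃ ε₂)`; the closed items
`ForwardSourceSmoothing`, `KPBreakOfCeiling` are discharged through `kp_not_noGlobalCascade_of_fwdCeilingKPAt`, the closed item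
`OrthantInvariance` is kept as a hypothesis (its proof module lies in another route's cone).
A reduction between statements (the small-ratio ceiling is OPEN); MODEL lattice only; no rung target is proved.
[cite: Tao2016AveragedNS, §4 Thm. 4.2] -/
theorem taoLadderTarget_of_kpSmallRatioCeiling
    (hS : ∀ R : ℝ, 1 ≤ R → ∃ εR : ℝ, 0 < εR ∧ ∀ ε₀ : ℝ, 0 < ε₀ → ε₀ ≤ εR →
      ∀ α : Fin 4 → Fin 4 → Fin 4 → ℤ × ℤ × ℤ → ℝ,
      Literature.Analysis.FluidPDE.TaoCascade.InTableClass R α → (∀ (Y : Fin 4 → ℤ → ℝ → ℝ) (τ : ℝ), (∀ (j : Fin 4) (k : ℤ), 1 ≤ k → 0 ≤ Y j k τ) → ∀ δ : ℝ, 0 < δ → ∀ (i : Fin 4) (n : ℤ), 1 ≤ n → Y i n τ = 0 → 0 ≤ Literature.Analysis.FluidPDE.TaoCascade.quadTerm δ α Y i n τ) → (∀ a b i : Fin 4, a ≠ b → α a b i (0, 0, 1) = 0) → ∃ S : Finset (Fin 4), (∀ i, i ∉ S → ∀ j l : Fin 4, α i j l (0, 0, 1) = 0) ∧ ∃ θ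 : ℝ, 1 / 2 < θ ∧ ∃ C : ℝ, 0 ≤ C ∧ ∀ ν : ℝ, 0 < ν → ∀ (X₀ : Fin 4 → ℝ) (s : ℝ), 0 < s → ∀ X : Fin 4 → ℤ → ℝ → ℝ, (∀ (i : Fin 4) (k : ℤ), X i k 0 = if k = 0 then X₀ i else 0) → (∀ (i : Fin 4) (k : ℤ), k < 0 → ∀ t : ℝ, X i k t = 0) → (∃ M : ℝ, ∀ (t : ℝ) (i : Fin 4) (k : ℤ), (1 + (1 + ε₀) ^ ((10 : ℝ) * k)) * |X i k t| ≤ M) → (∀ (i : Fin 4) (k : ℤ), Continuous (X i k)) → (∀ (i : Fin 4) (k : ℤ), ∀ t ∈ Set.Icc (0 : ℝ) s, HasDerivWithinAt (X i k) (Literature.Analysis.FluidPDE.TaoCascade.quadTerm ε₀ α X i k t - ν * (1 + ε₀) ^ ((2 : ℝ) * k) * X i k t) (Set.Icc (0 : ℝ) s) t) → (∀ t ∈ Set.Icc (0 : ℝ) s, ∀ (i : Fin 4) (k : ℤ), 1 ≤ k → 0 ≤ X i k t) → ∀ n N : ℕ, n ≤ N → ∀ t ∈ Set.Icc (0 : ℝ)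 s, ∑ k ∈ Finset.Icc n N, ∑ i ∈ S, (1 / 2 : ℝ) * X i (k : ℤ) t ^ 2 ≤ C * (∑ i : Fin 4, (1 / 2 : ℝ) * X₀ i ^ 2) * (1 + ε₀) ^ (-(2 * θ * (n : ℝ))))
    (h2 : OrthantInvariance) (h5 : NonDiagonalOrthantBreak) (h4 : NonOrthantBreak) :
    Summit.NavierStokesRegularity.NavierStokesRegularity.Theses.TaoLadderRungTwoBreak.Target := by
  intro R hR
  obtain ⟨εR, hεR, HS⟩ := hS R hR
  obtain ⟨ε₃, hε₃, H3⟩ := h5 R hR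
  obtain ⟨ε₂, hε₂, H2⟩ := h4 R hR
  refine ⟨min εR (min ε₃ ε₂), lt_min hεR (lt_min hε₃ hε₂), ?_⟩
  intro ε₀ h0 hle α X₀ hα
  by_cases hO : (∀ (Y : Fin 4 → ℤ → ℝ → ℝ) (τ : ℝ), (∀ (j : Fin 4) (k : ℤ), 1 ≤ k → 0 ≤ Y j k τ) → ∀ δ : ℝ, 0 < δ → ∀ (i : Fin 4) (n : ℤ), 1 ≤ n → Y i n τ = 0 → 0 ≤ Literature.Analysis.FluidPDE.TaoCascade.quadTerm δ α Y i n τ)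
  · by_cases hD : (∀ a b i : Fin 4, a ≠ b → α a b i (0, 0, 1) = 0)
    · exact kp_not_noGlobalCascade_of_fwdCeilingKPAt h0 (HS ε₀ h0 (hle.trans (min_le_left _ _)) α) hα hO hD h2 X₀
    · exact H3 ε₀ h0 ((hle.trans (min_le_right _ _)).trans (min_le_left _ _)) α X₀ hα hO hD
  · exact H2 ε₀ h0 ((hle.trans (min_le_right _ _)).trans (min_le_right _ _)) α X₀ hα hO

/-- **Nothing is lost**: the typed crux `ForwardTailCeilingKP` (every `ε₀ ∈ (0, 1]`) implies the small-ratio KP ceiling (`εR = 1`).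
[cite: Tao2016AveragedNS, §4 (4.13)] -/
theorem kpSmallRatioCeiling_of_forwardTailCeilingKP (h : ForwardTailCeilingKP) :
    ∀ R : ℝ, 1 ≤ R → ∃ εR : ℝ, 0 < εR ∧ ∀ ε₀ : ℝ, 0 < ε₀ → ε₀ ≤ εR →
      ∀ α : Fin 4 → Fin 4 → Fin 4 → ℤ × ℤ × ℤ → ℝ,
      Literature.Analysis.FluidPDE.TaoCascade.InTableClass R α → (∀ (Y : Fin 4 → ℤ → ℝ → ℝ) (τ : ℝ), (∀ (j : Fin 4) (k : ℤ), 1 ≤ k → 0 ≤ Y j k τ) → ∀ δ : ℝ, 0 < δ → ∀ (i : Fin 4) (n : ℤ), 1 ≤ n → Y i n τ = 0 → 0 ≤ Literature.Analysis.FluidPDE.TaoCascade.quadTerm δ α Y i n τ) → (∀ a b i : Fin 4, a ≠ b → α a b i (0, 0, 1) = 0) → ∃ S : Finset (Fin 4), (∀ i, i ∉ S → ∀ j l : Fin 4, α i j l (0, 0, 1) = 0) ∧ ∃ θ : ℝ, 1 / 2 < θ ∧ ∃ C : ℝ, 0 ≤ C ∧ ∀ ν : ℝ, 0 < ν → ∀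 (X₀ : Fin 4 → ℝ) (s : ℝ), 0 < s → ∀ X : Fin 4 → ℤ → ℝ → ℝ, (∀ (i : Fin 4) (k : ℤ), X i k 0 = if k = 0 then X₀ i else 0) → (∀ (i : Fin 4) (k : ℤ), k < 0 → ∀ t : ℝ, X i k t = 0) → (∃ M : ℝ, ∀ (t : ℝ) (i : Fin 4) (k : ℤ), (1 + (1 + ε₀) ^ ((10 : ℝ) * k)) * |X i k t| ≤ M) → (∀ (i : Fin 4) (k : ℤ), Continuous (X i k)) → (∀ (i : Fin 4) (k : ℤ), ∀ t ∈ Set.Icc (0 : ℝ) s, HasDerivWithinAt (X i k) (Literature.Analysis.FluidPDE.TaoCascade.quadTerm ε₀ α X i k t - ν * (1 + ε₀) ^ ((2 : ℝ) * k) * X i k t) (Set.Icc (0 : ℝ) s) t) → (∀ t ∈ Set.Icc (0 : ℝ) s, ∀ (i : Fin 4) (k : ℤ), 1 ≤ k → 0 ≤ X i k t) → ∀ n N : ℕ, n ≤ N → ∀ t ∈ Set.Icc (0 : ℝ) s, ∑ k ∈ Finset.Icc n N, ∑ i ∈ S, (1 / 2 : ℝ) * X i (k : ℤ) t ^ 2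 ≤ C * (∑ i : Fin 4, (1 / 2 : ℝ) * X₀ i ^ 2) * (1 + ε₀) ^ (-(2 * θ * (n : ℝ))) :=
  fun R hR => ⟨1, one_pos, fun ε₀ h0 h1 α => h R hR ε₀ h0 h1 α⟩

/-- **Consistency check** (the typed route glue, recovered): the crux `ForwardTailCeilingKP`, `OrthantInvariance` and the two residuals
give the rung target — `Theses.SubOnsagerCeiling.closes` with `ForwardSourceSmoothing` and `KPBreakOfCeiling` discharged. [cite: Tao2016AveragedNS, §4 Thm. 4.2] -/
theorem taoLadderTarget_of_forwardTailCeilingKP (h1 : ForwardTailCeilingKP) (h2 : OrthantInvariance)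
    (h5 : NonDiagonalOrthantBreak) (h4 : NonOrthantBreak) :
    Summit.NavierStokesRegularity.NavierStokesRegularity.Theses.TaoLadderRungTwoBreak.Target :=
  taoLadderTarget_of_kpSmallRatioCeiling (kpSmallRatioCeiling_of_forwardTailCeilingKP h1) h2 h5 h4

end Summit.NavierStokesRegularity.NavierStokesRegularity.Theorems

end
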